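import Summits.BirchSwinnertonDyer.BirchSwinnertonDyer.Theorems.EisensteinPrimesSelmerAcQuotientCorankLeCurveLocalLambda
import Literature.NumberTheory.EllipticCurves.KellerYin2024.AnticyclotomicLocalEulerFactors
import Literature.NumberTheory.EllipticCurves.HasseWeilAbelianBadReduction
import HarnessLib

/-!
# (eq:Euler-comp) at an ADDITIVE place: `λ(𝒫_w(f_E)) = 0` for `E_K = E ×_ℚ K` at a Heegner place above an additive `ℓ`

Cell `bsd-eis`, width seat `bsd-line-x1-p1-w2` gen 23, crux 2 `GoodLatticeBDPValue` (stmt-BirchSwinnertonDyer-19032), line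
`halves` v33N; helper `--supports`, closes no stub. PROVED, no named fact, no `sorry`.

WHY. In Castella–Grossi–Lee–Skinner's (eq:Euler-comp) (proof of Thm. 2.2.2, held text paper:arxiv-2008.02571 p. 12
L104–121) the primes `ℓ ∣ N₀` (additive for `E`, `a_ℓ = 0`) contribute `λ(𝒫_w(φ)) + λ(𝒫_w(ψ)) − λ(𝒫_w(E))` with
`λ(𝒫_w(E)) = 0`: the Euler factor of `E` at an additive prime is `1` (Silverman §C.16) and stays `1` over the
imaginary quadratic `K` at a Heegner place `w ∣ ℓ` (`e(w|ℓ) = 1`, Tate's algorithm under unramified base change —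
LEAD x1-p1 g0's `SelmerAcQuotientCorankLeCurveLocalLambda.hasAdditiveReductionAt_baseChange_of_heegner`). In the tree's
closed-form currency: `curveLocalLambda κ (W.baseChange K) w = 0`, so the additive summand of the CONTENT stub 3a-A is
`charLocalLambda θsub w + charLocalLambda θquot w` with nothing to subtract — the companion of this seat's
`…GoodLatticeAnacongEulerCompMultiplicative` (multiplicative places) and `…GoodLatticeAnacongEulerCompSymmetry` (w ↔ w̄).

* `eulerFactorModP_baseChange_eq_one_of_hasAdditiveReductionAt` — `P̃_w(E_K) = 1` once `E_K` is additive at `w`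
  (any number field);
* `curveLocalLambda_eq_zero_of_hasAdditiveReductionAt` — hence `curveLocalLambda κ WK w = 0` (any `WK/K` additive at `w`);
* **`curveLocalLambda_baseChange_eq_zero_of_heegner`** — `E/ℚ` additive at the prime below a Heegner place `w ∋ N`.

HONEST FRAMING: helper lemmas on the tree's own objects; 0 stubs / cells / labels / tiers move; orphan for -19032 until a
CGLS-2.2.1-shaped typing of 3a-A consumes it; no summit statement, no case of BSD, no crux or stub is proved here.
References: [CastellaGrossiLeeSkinner2022] Thm. 2.2.1 (`a_ℓ ≡ 0` for `ℓ ∣ N₀`) / proof of Thm. 2.2.2 (eq:Euler-comp);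
[SilvermanAEC2009] §C.16, VII.5.4 (a); [KellerYin2024] §1.5; [GreenbergVatsal2000] §2 Prop. (2.4), p. 27.
-/

set_option autoImplicit false
set_option linter.dupNamespace false

noncomputable section

open scoped Classical

open NumberField IsDedekindDomain Field WeierstrassCurve Polynomial
  Literature.NumberTheory.EllipticCurves Literature.NumberTheory.GaloisRepresentations
  Literature.NumberTheory.EllipticCurves.KellerYin2024

namespace Summit.BirchSwinnertonDyer.BirchSwinnertonDyer.Theorems.GoodLatticeAnacongEulerCompAdditive

variable {p : ℕ} [hp : Fact p.Prime] {K : Type} [Field K] [NumberField K]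

omit hp in
/-- **`P̃_w = 1` at a place of additive reduction** (the reduced Euler factor of the tree's `GreenbergVatsal2000.eulerFactorModP`;
Silverman §C.16: `L_v(E,T) = 1`). [cite: SilvermanAEC2009, §C.16 (PDF p. 390)] -/
theorem eulerFactorModP_eq_one_of_hasAdditiveReductionAt (WK : WeierstrassCurve K) {w : HeightOneSpectrum (𝓞 K)}
    (hadd : WK.HasAdditiveReductionAt w) : GreenbergVatsal2000.eulerFactorModP WK p w = 1 := by
  unfold GreenbergVatsal2000.eulerFactorModP
  rw [localPolynomialAt_of_hasAdditiveReductionAt hadd, Polynomial.map_one]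

/-- **`λ(𝒫_w(f)) = 0` at a place of additive reduction** for any elliptic curve over a number field (`P̃_w = 1` has no
root; GV p. 27: "additive reduction and so the corresponding Euler factor is `1`. Thus `δ = 0`").
[cite: GreenbergVatsal2000, §2 Prop. (2.4) and p. 27] [cite: KellerYin2024, §1.5 (arXiv:2402.12781v2 TeX L1337–1341)] -/
theorem curveLocalLambda_eq_zero_of_hasAdditiveReductionAt (κ : ZpExtension K p) (WK : WeierstrassCurve K)
    {w : HeightOneSpectrum (𝓞 K)} (hadd : WK.HasAdditiveReductionAt w) : curveLocalLambda κ WK w = 0 := by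
  rw [curveLocalLambda_eq, eulerFactorModP_eq_one_of_hasAdditiveReductionAt WK hadd, ← C_1, rootMultiplicity_C,
    mul_zero]

/-- **`λ(𝒫_w(f_E)) = 0` for `E/ℚ` at a Heegner place `w` above an ADDITIVE prime** (`K` imaginary quadratic,
`SatisfiesHeegnerHypothesis N K`, `N ∈ w`, `E` additive at the prime of `ℚ` below `w`): `E_K` is additive at `w`
(`SelmerAcQuotientCorankLeCurveLocalLambda.hasAdditiveReductionAt_baseChange_of_heegner`, Silverman VII.5.4 (a) at
`e(w|ℓ) = 1`), so the previous lemma applies — the `ℓ ∣ N₀` terms of (eq:Euler-comp) have `λ(𝒫_w(E)) = 0`.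
[cite: CastellaGrossiLeeSkinner2022, Thm. 2.2.1 (a_ℓ ≡ 0 for ℓ ∣ N₀) and proof of Thm. 2.2.2 (eq:Euler-comp)]
[cite: SilvermanAEC2009, VII.5 Prop. 5.4 (a) and §C.16] -/
theorem curveLocalLambda_baseChange_eq_zero_of_heegner (W : WeierstrassCurve ℚ) [W.IsElliptic]
    (hK : IsImaginaryQuadratic K) {N : ℕ} (hHN : SatisfiesHeegnerHypothesis N K) (κ : ZpExtension K p)
    {w : HeightOneSpectrum (𝓞 K)} (hNw : ((N : ℤ) : 𝓞 K) ∈ w.asIdeal)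
    (hadd : W.HasAdditiveReductionAt (w.under (𝓞 ℚ))) :
    curveLocalLambda κ (W.baseChange K) w = 0 :=
  curveLocalLambda_eq_zero_of_hasAdditiveReductionAt κ (W.baseChange K)
    (SelmerAcQuotientCorankLeCurveLocalLambda.hasAdditiveReductionAt_baseChange_of_heegner W hK hHN w hNw hadd)

/-- **The (eq:Euler-comp) summand at an additive Heegner place**: both local character terms stand and nothing is
subtracted — `charLocalLambda θsub w + charLocalLambda θquot w = curveLocalLambda (E_K) w + (charLocalLambda θsub w +
charLocalLambda θquot w)`, the `ℓ ∣ N₀` case of CGLS's `𝓔_{φ,ψ} = ∏_{ℓ∣N₀N₋} 𝒫_w(φ) ∏_{ℓ∣N₀N₊} 𝒫_w(ψ)` (both characters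
appear at `ℓ ∣ N₀`). [cite: CastellaGrossiLeeSkinner2022, Thm. 2.2.1 (𝓔_{φ,ψ}) and proof of Thm. 2.2.2 (eq:Euler-comp)] -/
theorem eulerComp_summand_of_hasAdditiveReductionAt_of_heegner (W : WeierstrassCurve ℚ) [W.IsElliptic]
    (hK : IsImaginaryQuadratic K) {N : ℕ} (hHN : SatisfiesHeegnerHypothesis N K) (κ : ZpExtension K p)
    (S : Set (PadicAlgCl p)) (θsub θquot : FramedGaloisRep K (padicCoeffIntegers S) 1)
    {w : HeightOneSpectrum (𝓞 K)} (hNw : ((N : ℤ) : 𝓞 K) ∈ w.asIdeal)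
    (hadd : W.HasAdditiveReductionAt (w.under (𝓞 ℚ))) :
    charLocalLambda S κ θsub w + charLocalLambda S κ θquot w =
      curveLocalLambda κ (W.baseChange K) w + (charLocalLambda S κ θsub w + charLocalLambda S κ θquot w) := by
  rw [curveLocalLambda_baseChange_eq_zero_of_heegner W hK hHN κ hNw hadd, zero_add]

end Summit.BirchSwinnertonDyer.BirchSwinnertonDyer.Theorems.GoodLatticeAnacongEulerCompAdditive

end
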